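import Summits.SmoothPoincare4.SmoothPoincare4.Theses.EntropyRung
import Literature.Geometry.Lorentzian.VolumeProofs
import Literature.Geometry.Lorentzian.VolumePositivity

/-!
# Negative-side lemmas for the crux `EntropyRung.SubcylindricalExistence` (stmt-SmoothPoincare4-10871):
# what constant test functions force on a witness, and why they force nothing more

For the typed entropy clause of the crux ("`ν(g) ≥ c`": `∀ τ > 0, ∀ f` smooth with `∫ (4πτ)⁻² e^{−f} dV = 1`,
`c ≤ ∫ [τ(R + |∇f|²) + f − 4] (4πτ)⁻² e^{−f} dV`) restricted to constants `f ≡ k`: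
* `constClause_bound`: `c ≤ τ (∫R)/V + log V − 2 log(4πτ) − 4` for every `τ > 0`;
* `constClause_totalScalar_pos`: `∫ R dV > 0`;  `constClause_exp_le_totalScalar_sq`: `e^{c+2}·64π²·V ≤ (∫R dV)²`;
* `constClause_iff`: conversely these two conditions IMPLY the constant clause (AM–GM) — the constant-test attack on
  the crux is exhausted;
* `entropyClause_*`: the same from the full clause (constants admissible, `|∇k|² = 0`), and the Bochner junk branch
  (`R` not integrable ⇒ only `c ≤ 0`);
* `subcylindricalWitness_totalScalar_sq`: for the crux's own clause (measure `riemannianMeasure`, `g.scalarCurvature`,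
  `g.gradSq`, `ContMDiff`) the volume hypothesis is discharged: any witness `g` of level `ν_cyl + δ` with integrable
  scalar curvature has `∫R dV > 0` and `e^{ν_cyl+δ+2}·64π²·Vol(M,g) ≤ (∫ R dV)²` (`= 128π^{5/2}e^{1/2}e^{δ}·Vol`;
  equality for the round `S⁴` at `δ = ν_round − ν_cyl`).
Stated definition-free (the clause hypotheses are spelled inline).  Context: the cdisprove record `Disproof.lean`
attached to the item, §3. [folklore]
-/

noncomputable section

open scoped Manifold ContDiff
open MeasureTheory Set Literature.Geometry.Lorentzian

namespace Summit.SmoothPoincare4.Cruxes.SubcylindricalExistence.Negative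

section ConstTest

variable {M : Type*} [MeasurableSpace M] {μ : Measure M} {R : M → ℝ} {G : (M → ℝ) → M → ℝ}
  {S : (M → ℝ) → Prop} {c : ℝ}

/-- The full clause implies its constant restriction as soon as constants are admissible (`S k`) and have
vanishing gradient square (`G k = 0`) — both hold in the crux (`contMDiff_const`, `gradSq_const`). -/
theorem entropyClause_constClause (h : (∀ τ : ℝ, 0 < τ → ∀ f : M → ℝ, S f →
      ∫ x, (4 * Real.pi * τ) ^ (-(4 : ℝ) / 2) * Real.exp (-f x) ∂μ = 1 →
      c ≤ ∫ x, (τ * (R x + G f x) + f x - 4) * ((4 * Real.pi * τ) ^ (-(4 : ℝ) / 2) * Real.exp (-f x)) ∂μ)) (hS : ∀ k : ℝ, S (fun _ ↦ k))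
    (hG : ∀ (k : ℝ) (x : M), G (fun _ ↦ k) x = 0) :
    (∀ τ : ℝ, 0 < τ → ∀ k : ℝ, ∫ _x, (4 * Real.pi * τ) ^ (-(4 : ℝ) / 2) * Real.exp (-k) ∂μ = 1 →
      c ≤ ∫ x, (τ * R x + k - 4) * ((4 * Real.pi * τ) ^ (-(4 : ℝ) / 2) * Real.exp (-k)) ∂μ) := by
  intro τ hτ k hk
  have := h τ hτ (fun _ ↦ k) (hS k) hk
  simpa only [hG, add_zero] using this

/-- **Constant test.** If the volume `V = μ.real univ` is positive (hence finite) and `R` is integrable,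
the constant clause at level `c` gives, for every `τ > 0`, `c ≤ τ (∫R)/V + log V − 2 log(4πτ) − 4`
(choose `k = log((4πτ)⁻² V)`). -/
theorem constClause_bound (h : (∀ τ : ℝ, 0 < τ → ∀ k : ℝ, ∫ _x, (4 * Real.pi * τ) ^ (-(4 : ℝ) / 2) * Real.exp (-k) ∂μ = 1 →
      c ≤ ∫ x, (τ * R x + k - 4) * ((4 * Real.pi * τ) ^ (-(4 : ℝ) / 2) * Real.exp (-k)) ∂μ)) (hV : 0 < μ.real univ) (hR : Integrable R μ)
    {τ : ℝ} (hτ : 0 < τ) :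
    c ≤ τ * (∫ x, R x ∂μ) / μ.real univ + Real.log (μ.real univ) - 2 * Real.log (4 * Real.pi * τ) - 4 := by
  set V : ℝ := μ.real univ with hVdef
  have hVne : μ univ ≠ ⊤ := by
    intro htop
    simp [hVdef, Measure.real, htop] at hV
  haveI : IsFiniteMeasure μ := ⟨lt_top_iff_ne_top.2 hVne⟩
  set A : ℝ := (4 * Real.pi * τ) ^ (-(4 : ℝ) / 2) with hAdef
  have hApos : 0 < A := Real.rpow_pos_of_pos (by positivity) _
  set k : ℝ := Real.log (A * V) with hkdef
  have hAk : A * Real.exp (-k) = V⁻¹ := by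
    rw [hkdef, Real.exp_neg, Real.exp_log (mul_pos hApos hV)]
    field_simp
  -- normalisation of the constant `k`
  have hnorm : ∫ _x, (4 * Real.pi * τ) ^ (-(4 : ℝ) / 2) * Real.exp (-k) ∂μ = 1 := by
    simp only [← hAdef]
    rw [integral_const, smul_eq_mul, hAk, ← hVdef]
    exact mul_inv_cancel₀ hV.ne'
  have hmain := h τ hτ k hnorm
  -- evaluate the right-hand side
  have hint : ∫ x, (τ * R x + k - 4) * ((4 * Real.pi * τ) ^ (-(4 : ℝ) / 2) * Real.exp (-k)) ∂μ =
      τ * (∫ x, R x ∂μ) / V + (k - 4) := by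
    simp only [← hAdef, hAk]
    rw [integral_mul_const]
    have hsplit : (fun x ↦ τ * R x + k - 4) = fun x ↦ τ * R x + (k - 4) := by
      funext x; ring
    rw [hsplit, integral_add (hR.const_mul τ) (integrable_const _), integral_const_mul, integral_const,
      smul_eq_mul, ← hVdef]
    field_simp
  have hk : k = -2 * Real.log (4 * Real.pi * τ) + Real.log V := by
    rw [hkdef, Real.log_mul hApos.ne' hV.ne', hAdef, Real.log_rpow (by positivity)]
    ring
  rw [hint, hk] at hmain
  linarith

/-- **The constant clause forces positive total scalar curvature**: `∫ R dV > 0` (else `τ → ∞` drives the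
bound to `−∞`). -/
theorem constClause_totalScalar_pos (h : (∀ τ : ℝ, 0 < τ → ∀ k : ℝ, ∫ _x, (4 * Real.pi * τ) ^ (-(4 : ℝ) / 2) * Real.exp (-k) ∂μ = 1 →
      c ≤ ∫ x, (τ * R x + k - 4) * ((4 * Real.pi * τ) ^ (-(4 : ℝ) / 2) * Real.exp (-k)) ∂μ)) (hV : 0 < μ.real univ) (hR : Integrable R μ) :
    0 < ∫ x, R x ∂μ := by
  by_contra hle
  push Not at hle
  set V : ℝ := μ.real univ
  -- choose τ with 2 log(4πτ) = log V − c, so that the bound collapses to `c ≤ c − 4 + τ (∫R)/V ≤ c − 4`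
  set τ : ℝ := Real.exp ((Real.log V - c) / 2) / (4 * Real.pi) with hτdef
  have hτ : 0 < τ := by positivity
  have hct := constClause_bound h hV hR hτ
  have h4 : 4 * Real.pi * τ = Real.exp ((Real.log V - c) / 2) := by
    rw [hτdef]; field_simp
  rw [h4, Real.log_exp] at hct
  have hneg : τ * (∫ x, R x ∂μ) / V ≤ 0 :=
    div_nonpos_of_nonpos_of_nonneg (mul_nonpos_of_nonneg_of_nonpos hτ.le hle) hV.le
  linarith

/-- **The sharp constant-test inequality** `e^{c+2}·64π²·Vol ≤ (∫ R dV)²` (take `τ = 2 Vol/∫R`). -/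
theorem constClause_exp_le_totalScalar_sq (h : (∀ τ : ℝ, 0 < τ → ∀ k : ℝ, ∫ _x, (4 * Real.pi * τ) ^ (-(4 : ℝ) / 2) * Real.exp (-k) ∂μ = 1 →
      c ≤ ∫ x, (τ * R x + k - 4) * ((4 * Real.pi * τ) ^ (-(4 : ℝ) / 2) * Real.exp (-k)) ∂μ)) (hV : 0 < μ.real univ)
    (hR : Integrable R μ) :
    Real.exp (c + 2) * (64 * Real.pi ^ 2) * μ.real univ ≤ (∫ x, R x ∂μ) ^ 2 := by
  set V : ℝ := μ.real univ
  set I : ℝ := ∫ x, R x ∂μ with hIdef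
  have hI : 0 < I := constClause_totalScalar_pos h hV hR
  set τ : ℝ := 2 * V / I with hτdef
  have hτ : 0 < τ := by positivity
  have hct := constClause_bound h hV hR hτ
  rw [← hIdef] at hct
  have h1 : τ * I / V = 2 := by
    rw [hτdef]; field_simp
  have h2 : 4 * Real.pi * τ = 8 * Real.pi * V / I := by
    rw [hτdef]; ring
  rw [h1, h2] at hct
  -- `c + 2 ≤ log V − 2 log (8πV/I) = log (I² / (64 π² V))`
  have hQpos : 0 < I ^ 2 / (64 * Real.pi ^ 2 * V) := by positivity
  have hlog : Real.log V - 2 * Real.log (8 * Real.pi * V / I) = Real.log (I ^ 2 / (64 * Real.pi ^ 2 * V)) := by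
    have h8 : (0 : ℝ) < 8 * Real.pi * V / I := by positivity
    have hp : (2 : ℝ) * Real.log (8 * Real.pi * V / I) = Real.log ((8 * Real.pi * V / I) ^ 2) := by
      rw [Real.log_pow]; norm_num
    rw [hp, ← Real.log_div hV.ne' (pow_pos h8 2).ne']
    congr 1
    field_simp
    ring
  have hc2 : c + 2 ≤ Real.log (I ^ 2 / (64 * Real.pi ^ 2 * V)) := by linarith
  have hexp := (Real.le_log_iff_exp_le hQpos).1 hc2
  rw [le_div_iff₀ (by positivity)] at hexp
  linarith

/-- **Constants are exhausted by §3** (tightness of the attack): conversely, `∫ R dV > 0` together with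
`e^{c+2}·64π²·Vol ≤ (∫R dV)²` IMPLIES the constant clause at level `c` (AM–GM: `y − 1 − log y ≥ 0` at
`y = τ ∫R/(2 Vol)`).  So no further necessary condition on a witness can be extracted from constant test functions
— and constants are the only test functions an abstract `M` provides; every sharper attack needs concentrated
(Gaussian) test functions, i.e. charts, injectivity radius and curvature expansions not in the library. -/
theorem constClause_iff (hV : 0 < μ.real univ) (hR : Integrable R μ) :
    (∀ τ : ℝ, 0 < τ → ∀ k : ℝ, ∫ _x, (4 * Real.pi * τ) ^ (-(4 : ℝ) / 2) * Real.exp (-k) ∂μ = 1 →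
      c ≤ ∫ x, (τ * R x + k - 4) * ((4 * Real.pi * τ) ^ (-(4 : ℝ) / 2) * Real.exp (-k)) ∂μ) ↔
      0 < ∫ x, R x ∂μ ∧ Real.exp (c + 2) * (64 * Real.pi ^ 2) * μ.real univ ≤ (∫ x, R x ∂μ) ^ 2 := by
  refine ⟨fun h ↦ ⟨constClause_totalScalar_pos h hV hR, constClause_exp_le_totalScalar_sq h hV hR⟩,
    fun ⟨hI, hexp⟩ ↦ ?_⟩
  set V : ℝ := μ.real univ with hVdef
  set I : ℝ := ∫ x, R x ∂μ with hIdef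
  have hVne : μ univ ≠ ⊤ := by
    intro htop
    simp [hVdef, Measure.real, htop] at hV
  haveI : IsFiniteMeasure μ := ⟨lt_top_iff_ne_top.2 hVne⟩
  intro τ hτ k hk
  set A : ℝ := (4 * Real.pi * τ) ^ (-(4 : ℝ) / 2) with hAdef
  have hApos : 0 < A := Real.rpow_pos_of_pos (by positivity) _
  -- the normalisation pins `A e^{-k} = 1/V`
  have hAk : A * Real.exp (-k) = V⁻¹ := by
    rw [integral_const, smul_eq_mul, ← hVdef] at hk
    field_simp
    linarith
  have hk' : k = Real.log A + Real.log V := by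
    have h1 : Real.exp (-k) = (A * V)⁻¹ := by
      field_simp
      have := hAk
      field_simp at this
      linarith
    have h2 : -k = Real.log ((A * V)⁻¹) := by rw [← h1, Real.log_exp]
    rw [Real.log_inv, Real.log_mul hApos.ne' hV.ne'] at h2
    linarith
  -- evaluate the right-hand side as in `constClause_bound`
  have hint : ∫ x, (τ * R x + k - 4) * ((4 * Real.pi * τ) ^ (-(4 : ℝ) / 2) * Real.exp (-k)) ∂μ =
      τ * I / V + (k - 4) := by
    simp only [← hAdef, hAk]
    rw [integral_mul_const]
    have hsplit : (fun x ↦ τ * R x + k - 4) = fun x ↦ τ * R x + (k - 4) := by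
      funext x; ring
    rw [hsplit, integral_add (hR.const_mul τ) (integrable_const _), integral_const_mul, integral_const,
      smul_eq_mul, ← hVdef, ← hIdef]
    field_simp
  rw [hint, hk', hAdef, Real.log_rpow (by positivity)]
  -- target: c ≤ τ I / V + (-(4/2) log(4πτ) + log V − 4); from `hexp`: c + 2 ≤ log (I²/(64π²V))
  have hQpos : 0 < I ^ 2 / (64 * Real.pi ^ 2 * V) := by positivity
  have hc2 : c + 2 ≤ Real.log (I ^ 2 / (64 * Real.pi ^ 2 * V)) := by
    rw [Real.le_log_iff_exp_le hQpos, le_div_iff₀ (by positivity)]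
    linarith
  -- AM–GM step: with y = τ I / (2V) > 0, `log y ≤ y − 1`
  set y : ℝ := τ * I / (2 * V) with hydef
  have hy : 0 < y := by positivity
  have hlogy := Real.log_le_sub_one_of_pos hy
  have hylog : Real.log y = Real.log τ + Real.log I - Real.log (2 * V) := by
    rw [hydef, Real.log_div (by positivity) (by positivity), Real.log_mul hτ.ne' hI.ne']
  have hQlog : Real.log (I ^ 2 / (64 * Real.pi ^ 2 * V)) =
      2 * Real.log I - (Real.log 64 + 2 * Real.log Real.pi + Real.log V) := by
    rw [Real.log_div (by positivity) (by positivity), Real.log_mul (by positivity) hV.ne',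
      Real.log_mul (by positivity) (by positivity), Real.log_pow, Real.log_pow]
    push_cast
    ring
  have h4pi : Real.log (4 * Real.pi * τ) = Real.log 4 + Real.log Real.pi + Real.log τ := by
    rw [Real.log_mul (by positivity) hτ.ne', Real.log_mul (by positivity) Real.pi_pos.ne']
  have h2V : Real.log (2 * V) = Real.log 2 + Real.log V := Real.log_mul (by positivity) hV.ne'
  have h64 : Real.log 64 = 6 * Real.log 2 := by
    rw [show (64 : ℝ) = 2 ^ 6 by norm_num, Real.log_pow]; push_cast; ring
  have h4 : Real.log 4 = 2 * Real.log 2 := by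
    rw [show (4 : ℝ) = 2 ^ 2 by norm_num, Real.log_pow]; push_cast; ring
  have hyV : τ * I / V = 2 * y := by
    rw [hydef]; field_simp
  rw [hyV]
  nlinarith [hlogy, hc2, hQlog, hylog, h4pi, h2V, h64, h4]

/-- Full-clause version of `constClause_totalScalar_pos` (constants admissible with zero gradient square). -/
theorem entropyClause_totalScalar_pos (h : (∀ τ : ℝ, 0 < τ → ∀ f : M → ℝ, S f →
      ∫ x, (4 * Real.pi * τ) ^ (-(4 : ℝ) / 2) * Real.exp (-f x) ∂μ = 1 →
      c ≤ ∫ x, (τ * (R x + G f x) + f x - 4) * ((4 * Real.pi * τ) ^ (-(4 : ℝ) / 2) * Real.exp (-f x)) ∂μ)) (hS : ∀ k : ℝ, S (fun _ ↦ k))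
    (hG : ∀ (k : ℝ) (x : M), G (fun _ ↦ k) x = 0) (hV : 0 < μ.real univ) (hR : Integrable R μ) :
    0 < ∫ x, R x ∂μ :=
  constClause_totalScalar_pos (entropyClause_constClause h hS hG) hV hR

/-- `EntropyClause` version of the sharp constant-test inequality.  For the crux (`c = ν_cyl + δ`) the left
side is `128 π^{5/2} e^{1/2} e^{δ}·Vol ≈ 3692·e^{δ}·Vol`; the round `S⁴(r)` has `(∫R)²/Vol = 384π² ≈ 3790`,
ratio `e^{ν_round − ν_cyl − δ}` — equality exactly at `δ = 0.02625`, so the round metric can witness no level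
above `ν_round` and the inequality cannot be improved by a universal factor (tightness). -/
theorem entropyClause_exp_le_totalScalar_sq (h : (∀ τ : ℝ, 0 < τ → ∀ f : M → ℝ, S f →
      ∫ x, (4 * Real.pi * τ) ^ (-(4 : ℝ) / 2) * Real.exp (-f x) ∂μ = 1 →
      c ≤ ∫ x, (τ * (R x + G f x) + f x - 4) * ((4 * Real.pi * τ) ^ (-(4 : ℝ) / 2) * Real.exp (-f x)) ∂μ)) (hS : ∀ k : ℝ, S (fun _ ↦ k))
    (hG : ∀ (k : ℝ) (x : M), G (fun _ ↦ k) x = 0) (hV : 0 < μ.real univ) (hR : Integrable R μ) :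
    Real.exp (c + 2) * (64 * Real.pi ^ 2) * μ.real univ ≤ (∫ x, R x ∂μ) ^ 2 :=
  constClause_exp_le_totalScalar_sq (entropyClause_constClause h hS hG) hV hR

/-- **Junk branch.** If `R` is NOT integrable (so that the `𝒲`-integrand of a constant is not, and its Bochner
integral is `0`) the clause only says `c ≤ 0` — satisfied by the crux level `ν_cyl + δ` for every
`δ < 3/2 − log 2 − ½ log π ≈ 0.2345`.  So Bochner junk never refutes the crux; it can only help it. -/
theorem entropyClause_nonpos_of_not_integrable (h : (∀ τ : ℝ, 0 < τ → ∀ f : M → ℝ, S f →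
      ∫ x, (4 * Real.pi * τ) ^ (-(4 : ℝ) / 2) * Real.exp (-f x) ∂μ = 1 →
      c ≤ ∫ x, (τ * (R x + G f x) + f x - 4) * ((4 * Real.pi * τ) ^ (-(4 : ℝ) / 2) * Real.exp (-f x)) ∂μ)) (hS : ∀ k : ℝ, S (fun _ ↦ k))
    (hG : ∀ (k : ℝ) (x : M), G (fun _ ↦ k) x = 0) (hV : 0 < μ.real univ) (hR : ¬ Integrable R μ) :
    c ≤ 0 := by
  set V : ℝ := μ.real univ with hVdef
  have hVne : μ univ ≠ ⊤ := by
    intro htop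
    simp [hVdef, Measure.real, htop] at hV
  haveI : IsFiniteMeasure μ := ⟨lt_top_iff_ne_top.2 hVne⟩
  set A : ℝ := (4 * Real.pi * (1 : ℝ)) ^ (-(4 : ℝ) / 2) with hAdef
  have hApos : 0 < A := Real.rpow_pos_of_pos (by positivity) _
  set k : ℝ := Real.log (A * V) with hkdef
  have hAk : A * Real.exp (-k) = V⁻¹ := by
    rw [hkdef, Real.exp_neg, Real.exp_log (mul_pos hApos hV)]
    field_simp
  have hnorm : ∫ x, (4 * Real.pi * (1 : ℝ)) ^ (-(4 : ℝ) / 2) * Real.exp (-(fun _ : M ↦ k) x) ∂μ = 1 := by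
    simp only [← hAdef]
    rw [integral_const, smul_eq_mul, hAk, ← hVdef]
    exact mul_inv_cancel₀ hV.ne'
  have hmain := h 1 one_pos (fun _ ↦ k) (hS k) hnorm
  -- the integrand is not integrable, so its Bochner integral vanishes
  have hni : ¬ Integrable (fun x ↦ (1 * (R x + G (fun _ ↦ k) x) + (fun _ : M ↦ k) x - 4) *
      ((4 * Real.pi * (1 : ℝ)) ^ (-(4 : ℝ) / 2) * Real.exp (-(fun _ : M ↦ k) x))) μ := by
    intro hint
    apply hR
    simp only [hG, add_zero, one_mul, ← hAdef, hAk] at hint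
    have hVinv : (V⁻¹ : ℝ) ≠ 0 := inv_ne_zero hV.ne'
    have h1 : Integrable (fun x ↦ (R x + k - 4)) μ := by
      have := hint.mul_const V
      refine this.congr (Filter.Eventually.of_forall fun x ↦ ?_)
      simp only
      field_simp
    have h2 : Integrable (fun x ↦ (R x + k - 4) - (k - 4)) μ := h1.sub (integrable_const _)
    refine h2.congr (Filter.Eventually.of_forall fun x ↦ ?_)
    simp only
    ring
  rw [integral_undef hni] at hmain
  exact hmain

end ConstTest

/-- **Applied to the crux.** For a metric `g` satisfying the crux's entropy clause at level
`log 2 + ½ log π − 3/2 + δ` on a nonempty closed `M` (with `R` integrable for its own volume measure — true for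
smooth `g` on closed `M`, not yet in the library): `∫ R dV > 0` and `e^{ν_cyl+δ+2}·64π²·Vol ≤ (∫ R dV)²`.  The volume
hypothesis is discharged by `riemannianVolume_pos_of_isOpen` / `riemannianVolume_lt_top_of_isCompact_holds`.
[folklore] -/
theorem subcylindricalWitness_totalScalar_sq {M : Type} [TopologicalSpace M] [T2Space M]
    [SecondCountableTopology M] [ChartedSpace (EuclideanSpace ℝ (Fin 4)) M] [IsManifold (𝓡 4) ∞ M]
    [CompactSpace M] [T3Space M] [MeasurableSpace M] [BorelSpace M] [Nonempty M]
    (g : PseudoRiemannianMetric (𝓡 4) ∞ (EuclideanSpace ℝ (Fin 4)) (TangentSpace (𝓡 4) : M → Type _))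
    [g.HasLeviCivita] (hg : g.IsRiemannian) {δ : ℝ}
    (hcl : ∀ τ : ℝ, 0 < τ → ∀ f : M → ℝ, ContMDiff (𝓡 4) 𝓘(ℝ, ℝ) ∞ f →
      ∫ x, (4 * Real.pi * τ) ^ (-(4 : ℝ) / 2) * Real.exp (-f x)
        ∂(riemannianMeasure (g.toContMDiffRiemannianMetric hg)) = 1 →
      Real.log 2 + Real.log Real.pi / 2 - 3 / 2 + δ ≤
        ∫ x, (τ * (g.scalarCurvature x + g.gradSq f x) + f x - 4) *
          ((4 * Real.pi * τ) ^ (-(4 : ℝ) / 2) * Real.exp (-f x))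
          ∂(riemannianMeasure (g.toContMDiffRiemannianMetric hg)))
    (hR : Integrable g.scalarCurvature (riemannianMeasure (g.toContMDiffRiemannianMetric hg))) :
    0 < ∫ x, g.scalarCurvature x ∂(riemannianMeasure (g.toContMDiffRiemannianMetric hg)) ∧
    Real.exp (Real.log 2 + Real.log Real.pi / 2 - 3 / 2 + δ + 2) * (64 * Real.pi ^ 2) *
        (riemannianMeasure (g.toContMDiffRiemannianMetric hg)).real univ ≤
      (∫ x, g.scalarCurvature x ∂(riemannianMeasure (g.toContMDiffRiemannianMetric hg))) ^ 2 := by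
  have hS : ∀ k : ℝ, ContMDiff (𝓡 4) 𝓘(ℝ, ℝ) ∞ (fun _ : M ↦ k) := fun _ ↦ contMDiff_const
  have hG : ∀ (k : ℝ) (x : M), g.gradSq (fun _ ↦ k) x = 0 := fun k x ↦ g.gradSq_const k x
  have hV : 0 < (riemannianMeasure (g.toContMDiffRiemannianMetric hg)).real univ := by
    refine ENNReal.toReal_pos ?_ ?_
    · exact (riemannianVolume_pos_of_isOpen (g.toContMDiffRiemannianMetric hg) isOpen_univ univ_nonempty).ne'
    · exact (riemannianVolume_lt_top_of_isCompact_holds (g.toContMDiffRiemannianMetric hg) le_rfl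
        isCompact_univ).ne
  exact ⟨entropyClause_totalScalar_pos hcl hS hG hV hR, entropyClause_exp_le_totalScalar_sq hcl hS hG hV hR⟩

end Summit.SmoothPoincare4.Cruxes.SubcylindricalExistence.Negative

end
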